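/-
Copyright (c) 2026. All rights reserved.
Released under Apache 2.0 license as described in the file LICENSE.
-/
import Literature.NumberTheory.Automorphic.DefiniteMaximalOrdersRamifiedInvolutionEigenspaces
import Literature.NumberTheory.Automorphic.BrandtModuleCommProofs
import Mathlib.Algebra.DirectSum.LinearMap
import HarnessLib

/-!
# The Atkin–Lehner involution of the Brandt module of a maximal order of `B_{p,∞}` commutes with every Brandt matrix:
# `T(n)_{[I P],[I' P]} = T(n)_{[I],[I']}`, the Hecke-stable decomposition `ℚ^{Cls O} = E₊ ⊕ E₋`, and the traces of `T(n)`
# on `E_±` (Vignéras III §5 exercice 5.8 (d); Voight 41.3.4–(41.3.5); Gross 1987 §1)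

[tag: quaternion_algebra] [tag: class_number] [tag: hecke_operator]

Topic `NumberTheory/Automorphic`; THEOREMS ONLY (no definition, no named fact, no instance; net Literature debt `0`).
Lane `lit-hodgefound`, seat p12, gen 51 — sequel of `DefiniteMaximalOrdersRamifiedInvolutionEigenspaces.lean` (gen 50),
which identified the Brandt matrix `T(p)` of a Brandt setup `S : XiSetup 1 p` (a maximal order `O` of the definite
quaternion algebra of prime discriminant `p`) with the permutation matrix of the involution `W : [I] ↦ [I P]` of `Cls O` and
computed the dimensions `t = # Typ O` and `h - t` of its eigenspaces `E₊`, `E₋` on the Brandt module `ℚ^{Cls O}`.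

THE PRINTED STATEMENTS. Vignéras, LNM 800, Ch. III §5 exercice 5.8 (d): «Les matrices de Brandt et les matrices de
permutation engendrent une `R`-algèbre commutative» — here `R = ℤ`, the only permutation matrix is `T(p)` itself
(ex. 5.8 (b): `c(p) = 1` for `p ∣ D`), and (c): `P(A) P(B) = P(AB)` for `(A, B) = 1`, `P(p^a) P(p^b) = P(p^{a+b})` for
`p ∣ D`. Voight, *Quaternion Algebras*, 41.3.4–(41.3.5): the permutation matrices `P(𝔞)` (`I_i ↦ 𝔞 I_i`) satisfy
`P(𝔞) T(𝔫) = T(𝔫) P(𝔞)`; Prop. 41.3.1 (b), Cor. 41.3.15 (`T(O)` is commutative). Gross, *Heights and the special values of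
L-series* (1987), §1: the Eisenstein vector `e₀ = Σ e_i / w_i` and the degree map `deg : ℤ[Cls O] → ℤ`.

What is proved here, for `S : XiSetup 1 p` with `W c = [I_c P]`:

* §1 **all the Brandt matrices of a Brandt setup prime to the level commute** (`XiSetup.matrix_comm_of_coprime_level`, any
  type `(N⁺, N⁻)`, `gcd(m, N⁺) = gcd(n, N⁺) = 1`, transported from the tree's `EichlerPackage.commute_T_of_coprime_level`
  through the dictionary `BrandtData.ofOrder_T_equivRightIdealClass`); for a maximal order (`N⁺ = 1`) ALL `T(m), T(n)`
  commute (`XiSetup.matrix_comm_of_level_one`), in particular `T(n) T(p) = T(p) T(n)` for every `n`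
  (`XiSetup.matrix_mul_matrix_ramified_comm`) — ex. 5.8 (d).
* §2 the entries: `(T(n) T(p))_{c c'} = T(n)_{c, W c'}`, `(T(p) T(n))_{c c'} = T(n)_{W c, c'}`, hence
  **`T(n)_{W c, W c'} = T(n)_{c c'}`** (`XiSetup.matrix_apply_W_W`: the bijection `J ↦ J P` between the sub-ideals of
  `I_{c'}` in the class `c` and those of `I_{c'} P` in the class `W c`), `T(n)_{c, W c'} = T(n)_{W c, c'}`, the diagonal
  entries are `W`-invariant, and the «twisted trace» `tr(T(n) T(p)) = Σ_c T(n)_{c, W c}`.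
* §3 **`E₊` and `E₋` are stable under every `T(n)`** (`XiSetup.mapsTo_toLin_matrix_eigenspace`, Mathlib's
  `Module.End.mapsTo_genEigenspace_of_comm`); `T(n)` maps functions of the type to functions of the type
  (`XiSetup.exists_mulVec_comp_typeOf_eq`: the Brandt matrices act on `ℚ^{Typ O} ≅ E₊`).
* §4 the weights are `W`-invariant (`w_{W c} = w_c`, as `O_L(I P) = O_L(I)`), Gross's Eisenstein vector `(1/w_c)_c` and the
  constant vector lie in `E₊`, and **`E₋` consists of vectors of degree zero** (`Σ_c v_c = 0`, and `Σ_c v_c / w_c = 0`).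
* §5 **the traces of `T(n)` on `E_±`**: `2 tr(T(n)|E₊) = tr T(n) + tr(T(n) T(p))` and `2 tr(T(n)|E₋) = tr T(n) - tr(T(n) T(p))`
  (`XiSetup.two_mul_trace_restrict_eigenspace_one` / `_neg_one`, from `ℚ^{Cls O} = E₊ ⊕ E₋`,
  Mathlib's `LinearMap.trace_eq_sum_trace_restrict`); for `n = 1` this is `2t = h + tr T(p)` of `DeuringTypeNumberFormula.lean`.

## References

* [VignerasLNM800] M.-F. Vignéras, *Arithmétique des algèbres de quaternions*, LNM 800 (1980), Ch. III §5 exercice 5.8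
  (b)–(d) (p. 87 of the held copy); Ch. V §2 (after Cor. 2.5: `Σ_A trace P(A) = 2^r t`).
* [Voight2021] J. Voight, *Quaternion Algebras*, GTM 288: Prop. 41.3.1, 41.3.4–(41.3.5), Cor. 41.3.15, Cor. 41.4.10; Cor. 18.5.12.
* [Gross1987] B. H. Gross, *Heights and the special values of L-series*, CMS Conf. Proc. 7 (1987), §1 (`e₀`, `deg`).

## Scope (honest)

Theorems only, for setups of type `(1, p)` except §1 (`matrix_comm_of_coprime_level`, every type). The commutation
`T(n) T(p) = T(p) T(n)` is obtained by transport from the tree's `BrandtData` layer, not by re-running the bijection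
`J ↦ J P`; the general squarefree-discriminant / Eichler-level form of the Atkin–Lehner group is not treated.
-/

noncomputable section

open scoped Pointwise Matrix

namespace Literature.NumberTheory.Automorphic

open HeckeTraceFormulaGL2Level
open Literature.NumberTheory.QuadraticFields.Quadratic

namespace Brandt

/-! ## §1 The Brandt matrices of a setup prime to the level commute -/

section Commute

variable {Nplus Nminus : ℕ}

/-- **`T(m) T(n) = T(n) T(m)` for `m, n` prime to the level `N⁺`** (every Brandt setup of type `(N⁺, N⁻)`; `m, n` need not be
coprime to each other nor to `N⁻`): Vignéras III §5 ex. 5.8 (c)–(d), transported from the tree's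
`EichlerPackage.commute_T_of_coprime_level` (`BrandtData` layer) along `BrandtData.ofOrder_T_equivRightIdealClass`.
[cite: VignerasLNM800, Ch. III §5 exercice 5.8 (c)–(d)] [cite: Voight2021, Prop. 41.3.1 and Cor. 41.3.15] -/
theorem XiSetup.matrix_comm_of_coprime_level (S : XiSetup Nplus Nminus) [Fintype (ClassSet S.O)] {m n : ℕ}
    (hm : m.Coprime Nplus) (hn : n.Coprime Nplus) : matrix S.O m * matrix S.O n = matrix S.O n * matrix S.O m := by
  have hO : IsZOrder S.O := (isEichlerOrder_iff_brandt.mpr S.isEichlerOrder).isZOrder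
  have hri : rightIdeals S.O = invertibleRightIdeals S.O :=
    rightIdeals_eq_invertibleRightIdeals_of_isTotallyDefinite S.isTotallyDefinite hO
  have key := (S.toEichlerPackage.commute_T_of_coprime_level m hm n hn).eq
  set e := ClassSet.equivRightIdealClass hri with he
  have hT : ∀ (k : ℕ) (i j : ClassSet S.O), (BrandtData.ofOrder S.O hO).T k (e i) (e j) = matrix S.O k j i :=
    fun k i j => BrandtData.ofOrder_T_equivRightIdealClass hO hri k i j
  letI : Fintype (RightIdealClass S.O) := (BrandtData.ofOrder S.O hO).instFintype
  ext i j
  have hent := congrFun (congrFun key (e j)) (e i)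
  simp only [Matrix.mul_apply] at hent
  rw [Matrix.mul_apply, Matrix.mul_apply]
  have h1 : ∑ k, matrix S.O m i k * matrix S.O n k j =
      ∑ x, (BrandtData.ofOrder S.O hO).T n (e j) x * (BrandtData.ofOrder S.O hO).T m x (e i) := by
    refine Fintype.sum_equiv e _ _ fun k => ?_
    rw [hT, hT, mul_comm]
  have h2 : ∑ k, matrix S.O n i k * matrix S.O m k j =
      ∑ x, (BrandtData.ofOrder S.O hO).T m (e j) x * (BrandtData.ofOrder S.O hO).T n x (e i) := by
    refine Fintype.sum_equiv e _ _ fun k => ?_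
    rw [hT, hT, mul_comm]
  rw [h1, h2]
  exact hent.symm

/-- **For a maximal order (`N⁺ = 1`) all Brandt matrices commute**: `T(m) T(n) = T(n) T(m)` for all `m, n`, including the
matrices at the ramified primes (Vignéras III §5 ex. 5.8 (d): the Brandt matrices and the permutation matrices generate a
commutative algebra). [cite: VignerasLNM800, Ch. III §5 exercice 5.8 (d)] [cite: Voight2021, 41.3.4–(41.3.5) and Cor. 41.3.15] -/
theorem XiSetup.matrix_comm_of_level_one (S : XiSetup 1 Nminus) [Fintype (ClassSet S.O)] (m n : ℕ) :
    matrix S.O m * matrix S.O n = matrix S.O n * matrix S.O m :=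
  S.matrix_comm_of_coprime_level (Nat.coprime_one_right m) (Nat.coprime_one_right n)

end Commute

variable {p : ℕ} [hp : Fact p.Prime] (S : XiSetup 1 p)

/-! ## §2 The entries of `T(n) T(p)` and `T(p) T(n)`: `T(n)_{W c, W c'} = T(n)_{c c'}` -/

section Entries

variable [Fintype (ClassSet S.O)]

omit hp in
/-- **`T(n) T(p) = T(p) T(n)` for every `n`** for the maximal orders of `B_{p,∞}` (the Atkin–Lehner involution commutes with
all Hecke operators). [cite: VignerasLNM800, Ch. III §5 exercice 5.8 (d)] [cite: Voight2021, (41.3.5)] -/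
theorem XiSetup.matrix_mul_matrix_ramified_comm (n : ℕ) : matrix S.O n * matrix S.O p = matrix S.O p * matrix S.O n :=
  XiSetup.matrix_comm_of_level_one S n p

/-- **`(T(n) T(p))_{c c'} = T(n)_{c, W c'}`** (`T(p)` is the permutation matrix of `W : c' ↦ [I_{c'} P]`). [cite: VignerasLNM800, Ch. III §5 exercice 5.8 (b)] [cite: Voight2021, 41.3.4] -/
theorem XiSetup.matrix_mul_matrix_ramified_apply (n : ℕ) (c c' : ClassSet S.O) :
    (matrix S.O n * matrix S.O p) c c' =
      matrix S.O n c (Quotient.mk (rightClassSetoid S.O) ⟨c'.rep * normPrimeIdeal S.O p, S.rep_mul_normPrimeIdeal_mem c'⟩) := by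
  classical
  rw [Matrix.mul_apply]
  simp only [S.matrix_ramified_apply, mul_ite, mul_one, mul_zero, Finset.sum_ite_eq', Finset.mem_univ, if_true]

/-- **`(T(p) T(n))_{c c'} = T(n)_{W c, c'}`** (`c = W d ⟺ d = W c`, `W` an involution). [cite: VignerasLNM800, Ch. III §5 exercice 5.8 (b)–(c)] [cite: Voight2021, 41.3.4] -/
theorem XiSetup.matrix_ramified_mul_matrix_apply (n : ℕ) (c c' : ClassSet S.O) :
    (matrix S.O p * matrix S.O n) c c' =
      matrix S.O n (Quotient.mk (rightClassSetoid S.O) ⟨c.rep * normPrimeIdeal S.O p, S.rep_mul_normPrimeIdeal_mem c⟩) c' := by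
  classical
  rw [Matrix.mul_apply]
  have h : ∀ d : ClassSet S.O, matrix S.O p c d = matrix S.O p d c := fun d => S.matrix_ramified_symm c d
  simp only [h, S.matrix_ramified_apply, ite_mul, one_mul, zero_mul, Finset.sum_ite_eq', Finset.mem_univ, if_true]

/-- **`T(n)_{c, W c'} = T(n)_{W c, c'}`** (the `(c, c')` entry of `T(n) T(p) = T(p) T(n)`). [cite: VignerasLNM800, Ch. III §5 exercice 5.8 (d)] [cite: Voight2021, (41.3.5)] -/
theorem XiSetup.matrix_apply_W_right (n : ℕ) (c c' : ClassSet S.O) :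
    matrix S.O n c (Quotient.mk (rightClassSetoid S.O) ⟨c'.rep * normPrimeIdeal S.O p, S.rep_mul_normPrimeIdeal_mem c'⟩) =
      matrix S.O n (Quotient.mk (rightClassSetoid S.O) ⟨c.rep * normPrimeIdeal S.O p, S.rep_mul_normPrimeIdeal_mem c⟩) c' := by
  rw [← S.matrix_mul_matrix_ramified_apply, ← S.matrix_ramified_mul_matrix_apply, S.matrix_mul_matrix_ramified_comm]

/-- **`T(n)_{W c, W c'} = T(n)_{c c'}` for every `n`**: the number of sub-ideals of `I_{c'} P` of index `n²` in the class
`[I_c P]` equals the number of sub-ideals of `I_{c'}` of index `n²` in the class `[I_c]` (the bijection `J ↦ J P`; here read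
off from `T(n) T(p) = T(p) T(n)` and `W² = 1`). [cite: VignerasLNM800, Ch. III §5 exercice 5.8 (c)–(d)] [cite: Voight2021, 41.3.4–(41.3.5)] -/
theorem XiSetup.matrix_apply_W_W (n : ℕ) (c c' : ClassSet S.O) :
    matrix S.O n (Quotient.mk (rightClassSetoid S.O) ⟨c.rep * normPrimeIdeal S.O p, S.rep_mul_normPrimeIdeal_mem c⟩)
        (Quotient.mk (rightClassSetoid S.O) ⟨c'.rep * normPrimeIdeal S.O p, S.rep_mul_normPrimeIdeal_mem c'⟩) =
      matrix S.O n c c' := by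
  rw [S.matrix_apply_W_right, S.mk_rep_mul_normPrimeIdeal_mul_normPrimeIdeal]

/-- The same with `W` moved to the other side: `T(n)_{W c, c'} = T(n)_{c, W c'}`. [cite: VignerasLNM800, Ch. III §5 exercice 5.8 (d)] -/
theorem XiSetup.matrix_apply_W_left (n : ℕ) (c c' : ClassSet S.O) :
    matrix S.O n (Quotient.mk (rightClassSetoid S.O) ⟨c.rep * normPrimeIdeal S.O p, S.rep_mul_normPrimeIdeal_mem c⟩) c' =
      matrix S.O n c (Quotient.mk (rightClassSetoid S.O) ⟨c'.rep * normPrimeIdeal S.O p, S.rep_mul_normPrimeIdeal_mem c'⟩) :=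
  (S.matrix_apply_W_right n c c').symm

/-- **The diagonal Brandt entries are `W`-invariant**: `T(n)_{W c, W c} = T(n)_{c c}` (also a consequence of
`typeOf (W c) = typeOf c` and the type invariance of the diagonal, `XiSetup.matrix_diag_eq_of_typeOf_eq`). [cite: VignerasLNM800, Ch. III §5 exercice 5.8 (d) and Ch. V §2 (diagonal terms)] -/
theorem XiSetup.matrix_diag_W (n : ℕ) (c : ClassSet S.O) :
    matrix S.O n (Quotient.mk (rightClassSetoid S.O) ⟨c.rep * normPrimeIdeal S.O p, S.rep_mul_normPrimeIdeal_mem c⟩)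
        (Quotient.mk (rightClassSetoid S.O) ⟨c.rep * normPrimeIdeal S.O p, S.rep_mul_normPrimeIdeal_mem c⟩) =
      matrix S.O n c c :=
  S.matrix_apply_W_W n c c

/-- **The twisted trace `tr(T(n) T(p)) = Σ_c T(n)_{c, W c}`** (the number of sub-ideal classes moved by `W` back to the
diagonal). [cite: VignerasLNM800, Ch. V §2 (after Cor. 2.5: `Σ_A trace P(A)`)] [cite: Voight2021, 41.3.4] -/
theorem XiSetup.trace_matrix_mul_matrix_ramified (n : ℕ) :
    (matrix S.O n * matrix S.O p).trace =
      ∑ c : ClassSet S.O, matrix S.O n c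
        (Quotient.mk (rightClassSetoid S.O) ⟨c.rep * normPrimeIdeal S.O p, S.rep_mul_normPrimeIdeal_mem c⟩) := by
  rw [Matrix.trace]
  exact Finset.sum_congr rfl fun c _ => by rw [Matrix.diag_apply, S.matrix_mul_matrix_ramified_apply]

/-- `tr(T(p) T(n)) = tr(T(n) T(p)) = Σ_c T(n)_{c, W c}`. [cite: VignerasLNM800, Ch. V §2 (after Cor. 2.5)] -/
theorem XiSetup.trace_matrix_ramified_mul_matrix (n : ℕ) :
    (matrix S.O p * matrix S.O n).trace =
      ∑ c : ClassSet S.O, matrix S.O n c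
        (Quotient.mk (rightClassSetoid S.O) ⟨c.rep * normPrimeIdeal S.O p, S.rep_mul_normPrimeIdeal_mem c⟩) := by
  rw [← S.matrix_mul_matrix_ramified_comm, S.trace_matrix_mul_matrix_ramified]

end Entries

/-! ## §3 `E₊` and `E₋` are stable under the Brandt matrices -/

section Stable

variable [Fintype (ClassSet S.O)] [DecidableEq (ClassSet S.O)]

omit hp in
/-- Casting commutes with products of Brandt matrices: `(T(m) T(n))_ℚ = T(m)_ℚ T(n)_ℚ`. [folklore] -/
private theorem map_matrix_mul' {Nplus Nminus : ℕ} (S : XiSetup Nplus Nminus) [Fintype (ClassSet S.O)] (m n : ℕ) :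
    (matrix S.O m * matrix S.O n).map (Int.cast : ℤ → ℚ) =
      (matrix S.O m).map (Int.cast : ℤ → ℚ) * (matrix S.O n).map (Int.cast : ℤ → ℚ) :=
  Matrix.map_mul (f := Int.castRingHom ℚ)

omit hp in
/-- **The linear maps `T(p)` and `T(n)` on `ℚ^{Cls O}` commute.** [cite: VignerasLNM800, Ch. III §5 exercice 5.8 (d)] -/
theorem XiSetup.commute_toLin_matrix_ramified (n : ℕ) :
    Commute (Matrix.toLin' ((matrix S.O p).map (Int.cast : ℤ → ℚ))) (Matrix.toLin' ((matrix S.O n).map (Int.cast : ℤ → ℚ))) := by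
  change Matrix.toLin' _ * Matrix.toLin' _ = Matrix.toLin' _ * Matrix.toLin' _
  rw [Module.End.mul_eq_comp, Module.End.mul_eq_comp, ← Matrix.toLin'_mul, ← Matrix.toLin'_mul, ← map_matrix_mul',
    ← map_matrix_mul', S.matrix_mul_matrix_ramified_comm]

omit hp in
/-- **Every eigenspace of `T(p)` on `ℚ^{Cls O}` is stable under every `T(n)`** (commuting operators; in particular `E₊` and
`E₋` are sub-Hecke-modules of the Brandt module). [cite: VignerasLNM800, Ch. III §5 exercice 5.8 (d)] [cite: Voight2021, Cor. 41.4.10] -/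
theorem XiSetup.mapsTo_toLin_matrix_eigenspace (n : ℕ) (μ : ℚ) :
    Set.MapsTo (Matrix.toLin' ((matrix S.O n).map (Int.cast : ℤ → ℚ)))
      (Module.End.eigenspace (Matrix.toLin' ((matrix S.O p).map (Int.cast : ℤ → ℚ))) μ)
      (Module.End.eigenspace (Matrix.toLin' ((matrix S.O p).map (Int.cast : ℤ → ℚ))) μ) :=
  Module.End.mapsTo_genEigenspace_of_comm (S.commute_toLin_matrix_ramified n) μ 1

omit hp in
/-- Membership form: `v ∈ E_μ ⟹ T(n) v ∈ E_μ`. [cite: VignerasLNM800, Ch. III §5 exercice 5.8 (d)] -/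
theorem XiSetup.mulVec_mem_eigenspace {n : ℕ} {μ : ℚ} {v : ClassSet S.O → ℚ}
    (hv : v ∈ Module.End.eigenspace (Matrix.toLin' ((matrix S.O p).map (Int.cast : ℤ → ℚ))) μ) :
    (matrix S.O n).map (Int.cast : ℤ → ℚ) *ᵥ v ∈
      Module.End.eigenspace (Matrix.toLin' ((matrix S.O p).map (Int.cast : ℤ → ℚ))) μ := by
  have h := S.mapsTo_toLin_matrix_eigenspace n μ hv
  rwa [Matrix.toLin'_apply] at h

/-- **The Brandt matrices act on the functions of the type**: for `g : Typ O → ℚ`, `T(n) (g ∘ typeOf)` is again of the form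
`g' ∘ typeOf` (`E₊ = {g ∘ typeOf}` is `T(n)`-stable) — the Hecke operators on `ℚ^{Typ O}`. [cite: Voight2021, Cor. 18.5.12 and Cor. 41.4.10] [cite: VignerasLNM800, Ch. III §5 exercice 5.8 (d)] -/
theorem XiSetup.exists_mulVec_comp_typeOf_eq (n : ℕ) (g : TypeSet S.O → ℚ) :
    ∃ g' : TypeSet S.O → ℚ, (matrix S.O n).map (Int.cast : ℤ → ℚ) *ᵥ (g ∘ typeOf S.O) = g' ∘ typeOf S.O :=
  (S.mem_eigenspace_one_iff_exists_comp_typeOf _).mp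
    (S.mulVec_mem_eigenspace ((S.mem_eigenspace_one_iff_exists_comp_typeOf _).mpr ⟨g, rfl⟩))

/-- `W`-invariant functions stay `W`-invariant under `T(n)`: `v ∘ W = v ⟹ (T(n) v) ∘ W = T(n) v`. [cite: VignerasLNM800, Ch. III §5 exercice 5.8 (d)] -/
theorem XiSetup.mulVec_W_of_forall_W (n : ℕ) {v : ClassSet S.O → ℚ}
    (hv : ∀ c : ClassSet S.O,
      v (Quotient.mk (rightClassSetoid S.O) ⟨c.rep * normPrimeIdeal S.O p, S.rep_mul_normPrimeIdeal_mem c⟩) = v c)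
    (c : ClassSet S.O) :
    ((matrix S.O n).map (Int.cast : ℤ → ℚ) *ᵥ v)
        (Quotient.mk (rightClassSetoid S.O) ⟨c.rep * normPrimeIdeal S.O p, S.rep_mul_normPrimeIdeal_mem c⟩) =
      ((matrix S.O n).map (Int.cast : ℤ → ℚ) *ᵥ v) c :=
  (S.mem_eigenspace_one_iff _).mp (S.mulVec_mem_eigenspace ((S.mem_eigenspace_one_iff v).mpr hv)) c

/-- `W`-anti-invariant functions stay `W`-anti-invariant under `T(n)`. [cite: VignerasLNM800, Ch. III §5 exercice 5.8 (d)] -/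
theorem XiSetup.mulVec_W_of_forall_W_neg (n : ℕ) {v : ClassSet S.O → ℚ}
    (hv : ∀ c : ClassSet S.O,
      v (Quotient.mk (rightClassSetoid S.O) ⟨c.rep * normPrimeIdeal S.O p, S.rep_mul_normPrimeIdeal_mem c⟩) = -v c)
    (c : ClassSet S.O) :
    ((matrix S.O n).map (Int.cast : ℤ → ℚ) *ᵥ v)
        (Quotient.mk (rightClassSetoid S.O) ⟨c.rep * normPrimeIdeal S.O p, S.rep_mul_normPrimeIdeal_mem c⟩) =
      -((matrix S.O n).map (Int.cast : ℤ → ℚ) *ᵥ v) c :=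
  (S.mem_eigenspace_neg_one_iff _).mp (S.mulVec_mem_eigenspace ((S.mem_eigenspace_neg_one_iff v).mpr hv)) c

end Stable

/-! ## §4 Weights, the Eisenstein vector and the degree on `E_±` -/

section Eisenstein

/-- **The Brandt weights are `W`-invariant: `w_{[I_c P]} = w_c`** (`O_L(I P) = O_L(I)`, and the weight is a function of
the left order). [cite: Gross1987, §1 (`w_i = |R_i^×|/2`)] [cite: Voight2021, 18.4.8 and 41.1.3] -/
theorem XiSetup.weight_W (c : ClassSet S.O) :
    weight S.O (Quotient.mk (rightClassSetoid S.O) ⟨c.rep * normPrimeIdeal S.O p, S.rep_mul_normPrimeIdeal_mem c⟩) =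
      weight S.O c :=
  weight_eq_weight_of_typeOf_eq (S.typeOf_mk_rep_mul_normPrimeIdeal c)

variable [Fintype (ClassSet S.O)] [DecidableEq (ClassSet S.O)]

/-- **Gross's Eisenstein vector `e₀ = (1/w_c)_c` lies in `E₊`** (it is `W`-invariant). [cite: Gross1987, §1 (`e₀ = Σ e_i/w_i`)] [cite: VignerasLNM800, Ch. III §5 exercice 5.8 (b)] -/
theorem XiSetup.eisensteinVector_mem_eigenspace_one :
    (fun c : ClassSet S.O => ((weight S.O c : ℚ))⁻¹) ∈
      Module.End.eigenspace (Matrix.toLin' ((matrix S.O p).map (Int.cast : ℤ → ℚ))) 1 :=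
  (S.mem_eigenspace_one_iff _).mpr fun c => by rw [S.weight_W]

/-- The constant vector lies in `E₊` (`T(p)` has column sums `1`). [cite: VignerasLNM800, Ch. III §5 exercice 5.8 (b) (`c(p) = 1`)] -/
theorem XiSetup.const_mem_eigenspace_one (a : ℚ) :
    (fun _ : ClassSet S.O => a) ∈ Module.End.eigenspace (Matrix.toLin' ((matrix S.O p).map (Int.cast : ℤ → ℚ))) 1 :=
  (S.mem_eigenspace_one_iff _).mpr fun _ => rfl

/-- **`E₋` has degree zero**: `v ∘ W = -v ⟹ Σ_c v_c = 0` (reindex the sum along the involution `W`). [cite: Gross1987, §1 (`deg`)] [cite: VignerasLNM800, Ch. III §5 exercice 5.8 (c)] -/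
theorem XiSetup.sum_eq_zero_of_mem_eigenspace_neg_one {v : ClassSet S.O → ℚ}
    (hv : v ∈ Module.End.eigenspace (Matrix.toLin' ((matrix S.O p).map (Int.cast : ℤ → ℚ))) (-1)) :
    ∑ c, v c = 0 := by
  rw [S.mem_eigenspace_neg_one_iff] at hv
  set W : ClassSet S.O → ClassSet S.O := fun c =>
    Quotient.mk (rightClassSetoid S.O) ⟨c.rep * normPrimeIdeal S.O p, S.rep_mul_normPrimeIdeal_mem c⟩ with hW
  have hWb : Function.Bijective W := S.bijective_mk_rep_mul_normPrimeIdeal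
  have h : ∑ c, v (W c) = ∑ c, v c := Fintype.sum_bijective W hWb (fun c => v (W c)) v fun _ => rfl
  have h' : ∑ c, v (W c) = ∑ c, -v c := Finset.sum_congr rfl fun c _ => hv c
  rw [Finset.sum_neg_distrib, h] at h'
  linarith

/-- **`E₋` is orthogonal to the Eisenstein vector**: `v ∘ W = -v ⟹ Σ_c v_c / w_c = 0` (the weights are `W`-invariant).
[cite: Gross1987, §1 (`⟨e_i, e_j⟩ = w_i δ_ij`, `e₀`)] [cite: VignerasLNM800, Ch. III §5 exercice 5.8 (c)] -/
theorem XiSetup.sum_div_weight_eq_zero_of_mem_eigenspace_neg_one {v : ClassSet S.O → ℚ}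
    (hv : v ∈ Module.End.eigenspace (Matrix.toLin' ((matrix S.O p).map (Int.cast : ℤ → ℚ))) (-1)) :
    ∑ c, v c / (weight S.O c : ℚ) = 0 := by
  rw [S.mem_eigenspace_neg_one_iff] at hv
  set W : ClassSet S.O → ClassSet S.O := fun c =>
    Quotient.mk (rightClassSetoid S.O) ⟨c.rep * normPrimeIdeal S.O p, S.rep_mul_normPrimeIdeal_mem c⟩ with hW
  have hWb : Function.Bijective W := S.bijective_mk_rep_mul_normPrimeIdeal
  have h : ∑ c, v (W c) / (weight S.O (W c) : ℚ) = ∑ c, v c / (weight S.O c : ℚ) :=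
    Fintype.sum_bijective W hWb (fun c => v (W c) / (weight S.O (W c) : ℚ)) (fun c => v c / (weight S.O c : ℚ)) fun _ => rfl
  have h' : ∑ c, v (W c) / (weight S.O (W c) : ℚ) = ∑ c, -(v c / (weight S.O c : ℚ)) :=
    Finset.sum_congr rfl fun c _ => by rw [hv c, show weight S.O (W c) = weight S.O c from S.weight_W c, neg_div]
  rw [Finset.sum_neg_distrib, h] at h'
  linarith

omit [DecidableEq (ClassSet S.O)] in
/-- `Σ_c v_{W c} = Σ_c v_c` (reindexing along the involution `W`). [cite: VignerasLNM800, Ch. III §5 exercice 5.8 (c)] -/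
theorem XiSetup.sum_comp_W (v : ClassSet S.O → ℚ) :
    ∑ c : ClassSet S.O, v (Quotient.mk (rightClassSetoid S.O) ⟨c.rep * normPrimeIdeal S.O p, S.rep_mul_normPrimeIdeal_mem c⟩) =
      ∑ c, v c := by
  have hWb : Function.Bijective (fun c : ClassSet S.O =>
      (Quotient.mk (rightClassSetoid S.O) ⟨c.rep * normPrimeIdeal S.O p, S.rep_mul_normPrimeIdeal_mem c⟩ : ClassSet S.O)) :=
    S.bijective_mk_rep_mul_normPrimeIdeal
  exact Fintype.sum_bijective (κ := ClassSet S.O) _ hWb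
    (fun c => v (Quotient.mk (rightClassSetoid S.O) ⟨c.rep * normPrimeIdeal S.O p, S.rep_mul_normPrimeIdeal_mem c⟩)) v
    fun _ => rfl

end Eisenstein

/-! ## §5 The traces of `T(n)` on `E₊` and `E₋` -/

section Traces

variable [Fintype (ClassSet S.O)] [DecidableEq (ClassSet S.O)]

omit hp in
/-- On `E_μ`, `T(n) T(p)` restricts to `μ · T(n)|E_μ`. [cite: VignerasLNM800, Ch. III §5 exercice 5.8 (d)] -/
theorem XiSetup.restrict_toLin_mul_ramified_eq (n : ℕ) (μ : ℚ)
    (h : Set.MapsTo (Matrix.toLin' ((matrix S.O n).map (Int.cast : ℤ → ℚ)) * Matrix.toLin' ((matrix S.O p).map (Int.cast : ℤ → ℚ)))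
      (Module.End.eigenspace (Matrix.toLin' ((matrix S.O p).map (Int.cast : ℤ → ℚ))) μ)
      (Module.End.eigenspace (Matrix.toLin' ((matrix S.O p).map (Int.cast : ℤ → ℚ))) μ)) :
    (Matrix.toLin' ((matrix S.O n).map (Int.cast : ℤ → ℚ)) * Matrix.toLin' ((matrix S.O p).map (Int.cast : ℤ → ℚ))).restrict h =
      μ • (Matrix.toLin' ((matrix S.O n).map (Int.cast : ℤ → ℚ))).restrict (S.mapsTo_toLin_matrix_eigenspace n μ) := by
  ext v
  have hv := Module.End.mem_eigenspace_iff.mp v.2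
  simp only [LinearMap.restrict_apply, LinearMap.smul_apply, Submodule.coe_smul, Module.End.mul_apply, hv, map_smul]

/-- `tr(T_ℚ) = tr T` for the cast of an integer matrix. [folklore] -/
private theorem trace_map_intCast' {ι : Type*} [Fintype ι] (M : Matrix ι ι ℤ) :
    (M.map (Int.cast : ℤ → ℚ)).trace = ((M.trace : ℤ) : ℚ) := by
  simp [Matrix.trace, Matrix.map_apply]

omit [DecidableEq (ClassSet S.O)] in
/-- `Σ_c (T(n)_{cc} + T(n)_{c, W c}) = tr T(n) + tr(T(n) T(p))`. [cite: VignerasLNM800, Ch. V §2 (after Cor. 2.5)] -/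
theorem XiSetup.sum_diag_add_W_eq (n : ℕ) :
    ∑ c : ClassSet S.O, ((matrix S.O n c c +
        matrix S.O n c (Quotient.mk (rightClassSetoid S.O) ⟨c.rep * normPrimeIdeal S.O p, S.rep_mul_normPrimeIdeal_mem c⟩) : ℤ) : ℚ) =
      ((matrix S.O n).trace : ℚ) + ((matrix S.O n * matrix S.O p).trace : ℚ) := by
  rw [S.trace_matrix_mul_matrix_ramified, Matrix.trace]
  simp only [Matrix.diag_apply]
  push_cast
  exact Finset.sum_add_distrib

omit [DecidableEq (ClassSet S.O)] in
/-- `Σ_c (T(n)_{cc} - T(n)_{c, W c}) = tr T(n) - tr(T(n) T(p))`. [cite: VignerasLNM800, Ch. V §2 (after Cor. 2.5)] -/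
theorem XiSetup.sum_diag_sub_W_eq (n : ℕ) :
    ∑ c : ClassSet S.O, ((matrix S.O n c c -
        matrix S.O n c (Quotient.mk (rightClassSetoid S.O) ⟨c.rep * normPrimeIdeal S.O p, S.rep_mul_normPrimeIdeal_mem c⟩) : ℤ) : ℚ) =
      ((matrix S.O n).trace : ℚ) - ((matrix S.O n * matrix S.O p).trace : ℚ) := by
  rw [S.trace_matrix_mul_matrix_ramified, Matrix.trace]
  simp only [Matrix.diag_apply]
  push_cast
  exact Finset.sum_sub_distrib _ _

/-- **`tr T(n) = tr(T(n)|E₊) + tr(T(n)|E₋)`** (`ℚ^{Cls O} = E₊ ⊕ E₋`, both stable). [cite: VignerasLNM800, Ch. III §5 exercice 5.8 (c)–(d)] -/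
theorem XiSetup.trace_eq_trace_restrict_add (n : ℕ) :
    ((matrix S.O n).trace : ℚ) =
      LinearMap.trace ℚ _ ((Matrix.toLin' ((matrix S.O n).map (Int.cast : ℤ → ℚ))).restrict (S.mapsTo_toLin_matrix_eigenspace n 1)) +
      LinearMap.trace ℚ _ ((Matrix.toLin' ((matrix S.O n).map (Int.cast : ℤ → ℚ))).restrict (S.mapsTo_toLin_matrix_eigenspace n (-1))) := by
  set Tp := Matrix.toLin' ((matrix S.O p).map (Int.cast : ℤ → ℚ)) with hTp
  set Tn := Matrix.toLin' ((matrix S.O n).map (Int.cast : ℤ → ℚ)) with hTn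
  set N : Bool → Submodule ℚ (ClassSet S.O → ℚ) := fun b => cond b (Module.End.eigenspace Tp 1) (Module.End.eigenspace Tp (-1))
    with hN
  have hint : DirectSum.IsInternal N := by
    refine (DirectSum.isInternal_submodule_iff_isCompl N (i := true) (j := false) (by decide) ?_).mpr ?_
    · ext b; cases b <;> simp
    · exact S.isCompl_eigenspace_one_eigenspace_neg_one
  have hf : ∀ b, Set.MapsTo Tn (N b) (N b) := fun b => by
    cases b
    · exact S.mapsTo_toLin_matrix_eigenspace n (-1)
    · exact S.mapsTo_toLin_matrix_eigenspace n 1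
  have key := LinearMap.trace_eq_sum_trace_restrict hint hf
  rw [Fintype.sum_bool] at key
  have htr : LinearMap.trace ℚ _ Tn = ((matrix S.O n).trace : ℚ) := by
    rw [hTn, Matrix.trace_toLin'_eq, trace_map_intCast']
  have h1 : LinearMap.trace ℚ _ (Tn.restrict (hf true)) = LinearMap.trace ℚ _ (Tn.restrict (S.mapsTo_toLin_matrix_eigenspace n 1)) := rfl
  have h2 : LinearMap.trace ℚ _ (Tn.restrict (hf false)) =
      LinearMap.trace ℚ _ (Tn.restrict (S.mapsTo_toLin_matrix_eigenspace n (-1))) := rfl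
  rw [← htr, key, h1, h2]

/-- **`tr(T(n) T(p)) = tr(T(n)|E₊) - tr(T(n)|E₋)`** (`T(p) = ±1` on `E_±`). [cite: VignerasLNM800, Ch. III §5 exercice 5.8 (c)–(d)] -/
theorem XiSetup.trace_mul_ramified_eq_trace_restrict_sub (n : ℕ) :
    ((matrix S.O n * matrix S.O p).trace : ℚ) =
      LinearMap.trace ℚ _ ((Matrix.toLin' ((matrix S.O n).map (Int.cast : ℤ → ℚ))).restrict (S.mapsTo_toLin_matrix_eigenspace n 1)) -
      LinearMap.trace ℚ _ ((Matrix.toLin' ((matrix S.O n).map (Int.cast : ℤ → ℚ))).restrict (S.mapsTo_toLin_matrix_eigenspace n (-1))) := by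
  set Tp := Matrix.toLin' ((matrix S.O p).map (Int.cast : ℤ → ℚ)) with hTp
  set Tn := Matrix.toLin' ((matrix S.O n).map (Int.cast : ℤ → ℚ)) with hTn
  set N : Bool → Submodule ℚ (ClassSet S.O → ℚ) := fun b => cond b (Module.End.eigenspace Tp 1) (Module.End.eigenspace Tp (-1))
    with hN
  have hint : DirectSum.IsInternal N := by
    refine (DirectSum.isInternal_submodule_iff_isCompl N (i := true) (j := false) (by decide) ?_).mpr ?_
    · ext b; cases b <;> simp
    · exact S.isCompl_eigenspace_one_eigenspace_neg_one
  have hmaps : ∀ μ : ℚ, Set.MapsTo (Tn * Tp) (Module.End.eigenspace Tp μ) (Module.End.eigenspace Tp μ) := fun μ v hv =>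
    S.mapsTo_toLin_matrix_eigenspace n μ (Module.End.mapsTo_genEigenspace_of_comm (Commute.refl Tp) μ 1 hv)
  have hf : ∀ b, Set.MapsTo (Tn * Tp) (N b) (N b) := fun b => by
    cases b
    · exact hmaps (-1)
    · exact hmaps 1
  have key := LinearMap.trace_eq_sum_trace_restrict hint hf
  rw [Fintype.sum_bool] at key
  have e1 : LinearMap.trace ℚ _ ((Tn * Tp).restrict (hf true)) = LinearMap.trace ℚ _ ((Tn * Tp).restrict (hmaps 1)) := rfl
  have e2 : LinearMap.trace ℚ _ ((Tn * Tp).restrict (hf false)) =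
      LinearMap.trace ℚ _ ((Tn * Tp).restrict (hmaps (-1))) := rfl
  have h1 : LinearMap.trace ℚ _ ((Tn * Tp).restrict (hmaps 1)) =
      LinearMap.trace ℚ _ (Tn.restrict (S.mapsTo_toLin_matrix_eigenspace n 1)) := by
    rw [S.restrict_toLin_mul_ramified_eq n 1 (hmaps 1), one_smul]
  have h2 : LinearMap.trace ℚ _ ((Tn * Tp).restrict (hmaps (-1))) =
      -LinearMap.trace ℚ _ (Tn.restrict (S.mapsTo_toLin_matrix_eigenspace n (-1))) := by
    rw [S.restrict_toLin_mul_ramified_eq n (-1) (hmaps (-1)), map_smul, smul_eq_mul, neg_one_mul]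
  have hprod : Tn * Tp = Matrix.toLin' ((matrix S.O n * matrix S.O p).map (Int.cast : ℤ → ℚ)) := by
    rw [hTn, hTp, Module.End.mul_eq_comp, ← Matrix.toLin'_mul]
    congr 1
    exact (Matrix.map_mul (f := Int.castRingHom ℚ)).symm
  have htr : LinearMap.trace ℚ _ (Tn * Tp) = ((matrix S.O n * matrix S.O p).trace : ℚ) := by
    rw [hprod, Matrix.trace_toLin'_eq, trace_map_intCast']
  rw [← htr, key, e1, e2, h1, h2, sub_eq_add_neg]

/-- **`2 tr(T(n)|E₊) = tr T(n) + tr(T(n) T(p)) = Σ_c (T(n)_{cc} + T(n)_{c, W c})`** — the trace of the `n`-th Brandt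
matrix on the `W`-invariant part `E₊ ≅ ℚ^{Typ O}` of the Brandt module; at `n = 1` this is `2t = h + tr T(p)`
(`XiSetup.two_mul_natCard_typeSet_eq_card_add_trace`). [cite: VignerasLNM800, Ch. V §2 (after Cor. 2.5: `Σ_A trace P(A) = 2^r t`)] [cite: Voight2021, Cor. 18.5.12 and 41.3.4] -/
theorem XiSetup.two_mul_trace_restrict_eigenspace_one (n : ℕ) :
    2 * LinearMap.trace ℚ _ ((Matrix.toLin' ((matrix S.O n).map (Int.cast : ℤ → ℚ))).restrict (S.mapsTo_toLin_matrix_eigenspace n 1)) =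
      ∑ c : ClassSet S.O, ((matrix S.O n c c +
        matrix S.O n c (Quotient.mk (rightClassSetoid S.O) ⟨c.rep * normPrimeIdeal S.O p, S.rep_mul_normPrimeIdeal_mem c⟩) : ℤ) : ℚ) := by
  have h1 := S.trace_eq_trace_restrict_add n
  have h2 := S.trace_mul_ramified_eq_trace_restrict_sub n
  have h3 := S.sum_diag_add_W_eq n
  linarith

/-- **`2 tr(T(n)|E₋) = tr T(n) - tr(T(n) T(p)) = Σ_c (T(n)_{cc} - T(n)_{c, W c})`.** [cite: VignerasLNM800, Ch. V §2 (after Cor. 2.5) and Ch. III §5 exercice 5.8 (d)] -/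
theorem XiSetup.two_mul_trace_restrict_eigenspace_neg_one (n : ℕ) :
    2 * LinearMap.trace ℚ _ ((Matrix.toLin' ((matrix S.O n).map (Int.cast : ℤ → ℚ))).restrict (S.mapsTo_toLin_matrix_eigenspace n (-1))) =
      ∑ c : ClassSet S.O, ((matrix S.O n c c -
        matrix S.O n c (Quotient.mk (rightClassSetoid S.O) ⟨c.rep * normPrimeIdeal S.O p, S.rep_mul_normPrimeIdeal_mem c⟩) : ℤ) : ℚ) := by
  have h1 := S.trace_eq_trace_restrict_add n
  have h2 := S.trace_mul_ramified_eq_trace_restrict_sub n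
  have h3 := S.sum_diag_sub_W_eq n
  linarith

/-- For `p ∤ n`: `tr(T(n) T(p)) = tr T(np)` (`T(n) T(p) = T(np)` by coprime multiplicativity), so
**`2 tr(T(n)|E₊) = tr T(n) + tr T(np)`**. [cite: VignerasLNM800, Ch. III §5 exercice 5.8 (c) and Ch. V §2] -/
theorem XiSetup.two_mul_trace_restrict_eigenspace_one_of_not_dvd {n : ℕ} (hn : ¬ p ∣ n) :
    2 * LinearMap.trace ℚ _ ((Matrix.toLin' ((matrix S.O n).map (Int.cast : ℤ → ℚ))).restrict (S.mapsTo_toLin_matrix_eigenspace n 1)) =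
      ((matrix S.O n).trace : ℚ) + ((matrix S.O (n * p)).trace : ℚ) := by
  have hcop : Nat.Coprime n p := ((Nat.Prime.coprime_iff_not_dvd hp.out).mpr hn).symm
  have h1 := S.trace_eq_trace_restrict_add n
  have h2 := S.trace_mul_ramified_eq_trace_restrict_sub n
  have h3 : matrix S.O (n * p) = matrix S.O n * matrix S.O p := S.matrix_mul_of_coprime hcop
  rw [h3]
  linarith

/-- Likewise **`2 tr(T(n)|E₋) = tr T(n) - tr T(np)`** for `p ∤ n`. [cite: VignerasLNM800, Ch. III §5 exercice 5.8 (c) and Ch. V §2] -/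
theorem XiSetup.two_mul_trace_restrict_eigenspace_neg_one_of_not_dvd {n : ℕ} (hn : ¬ p ∣ n) :
    2 * LinearMap.trace ℚ _ ((Matrix.toLin' ((matrix S.O n).map (Int.cast : ℤ → ℚ))).restrict (S.mapsTo_toLin_matrix_eigenspace n (-1))) =
      ((matrix S.O n).trace : ℚ) - ((matrix S.O (n * p)).trace : ℚ) := by
  have hcop : Nat.Coprime n p := ((Nat.Prime.coprime_iff_not_dvd hp.out).mpr hn).symm
  have h1 := S.trace_eq_trace_restrict_add n
  have h2 := S.trace_mul_ramified_eq_trace_restrict_sub n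
  have h3 : matrix S.O (n * p) = matrix S.O n * matrix S.O p := S.matrix_mul_of_coprime hcop
  rw [h3]
  linarith

end Traces

end Brandt

end Literature.NumberTheory.Automorphic

end
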